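import Mathlib
import Summits.ResolutionOfSingularities.ResolutionOfSingularities.Theorems.WildQuotientsWildQuotientResolutionPhaseZeroPClosed
import Literature.AlgebraicGeometry.Motives.AbelianVarietyIsogenyProofs
import Literature.AlgebraicGeometry.Motives.VarietiesDimensionProofs
import Literature.AlgebraicGeometry.Resolution.QuadraticTransformsUFD
import Literature.AlgebraicGeometry.Resolution.ResolutionOfSingularities

/-!
# Cyclic divisorial (Király–Lütkebohmert terminal) models — the research statement and its first rung
(crux stmt-ResolutionOfSingularities-15640 `WildQuotients.WildQuotientResolution`, line `Sketch`,
R-layer of `L/w45c/CHAIN.md` v1 / CRUX-PLAN v1)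

[OURS · L1 W4.5c] `CyclicDivisorialModelsLE p₀ d` is the EXISTENCE statement that the landed,
unconditional cyclic divisorial transfer (`CyclicTransfer.cyclicDivisorialTransfer`, p459590)
consumes: for a faithful action of `ℤ/p`, `p ≤ p₀`, on a regular integral `X′` finite and
`G`-invariantly over an integral separated finite-type `X₁` of dimension `≤ d` over a perfect field,
there is a `G`-equivariant proper birational regular integral model `V → X′` with a `G`-stable
affine cover on which every stalk augmentation ideal at a fixed point is principal (the
Király–Lütkebohmert terminal state). It is the honest open core of the line (known FALSE for
`p ≥ 5` already at `d = 2` by corner cycling, `Lines/Sketch_NegativeDivisorialModels.md`; OPEN for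
`p₀ = 3`). This file states it (verbatim from plan-1's checked signatures
`L/w45c/W45cPlanSignatures.lean`) and proves the free pieces: the `G`-stable affine cover conjunct
(`exists_stableAffineCover_of_isFinite`) and the rung `d = 1` (`cyclicDivisorialModelsLE_one`:
`X′` is its own terminal model, its stalks being fields or discrete valuation rings).
NOT a statement of the manuscript.
-/

set_option linter.dupNamespace false

noncomputable section

open CategoryTheory Limits AlgebraicGeometry TopologicalSpace
open Literature.AlgebraicGeometry.Resolution Literature.AlgebraicGeometry.Motives

namespace Summit.ResolutionOfSingularities.ResolutionOfSingularities.Theorems.WildQuotientResolution.CyclicTransfer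

/-- [OURS · L1 W4.5c] R1a `CyclicDivisorialModelsLE p₀ d`: **existence of scheme-level
Király–Lütkebohmert terminal models** for faithful actions of `ℤ/p`, `p ≤ p₀`, on regular `X′` in
the crux setting with `dim X₁ ≤ d` over a perfect field: a `G`-equivariant proper birational
regular integral model `V → X′` with a `G`-stable affine cover and principal stalk augmentation
ideals at fixed points. KNOWN FALSE for `p ≥ 5` already at `d = 2` (corner-cycling theorem,
`Lines/Sketch_NegativeDivisorialModels.md`); OPEN and kit-testable for `p₀ = 3`; with the
registered `cyclicDivisorialTransfer` it gives `CyclicQuotientFourfolds` for `p ≤ 3`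
UNCONDITIONALLY (`d = 4`). Research statement (a `Prop`), never a premise; NOT a statement of
the manuscript. -/
def CyclicDivisorialModelsLE (p₀ d : ℕ) : Prop :=
  ∀ p : ℕ, p.Prime → p ≤ p₀ → ∀ (k : Type) [Field k] [CharP k p] [PerfectField k]
    (X' X₁ : Scheme.{0}) (f : X₁ ⟶ Spec (.of k)) (q : X' ⟶ X₁) (G : Type) [Group G] [Finite G]
    (ρ : G →* Aut X'), Nat.card G = p → Function.Injective ρ →
    IsSeparated f → LocallyOfFiniteType f → QuasiCompact f → IsIntegral X₁ → IsIntegral X' →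
    Scheme.IsRegular X' → IsFinite q → (∀ g : G, (ρ g).hom ≫ q = q) →
    topologicalKrullDim X₁ ≤ d →
    ∃ (V : Scheme.{0}) (π : V ⟶ X') (ρV : G →* Aut V), IsProper π ∧ IsBirational π ∧
      IsIntegral V ∧ Scheme.IsRegular V ∧ (∀ g : G, (ρV g).hom ≫ π = π ≫ (ρ g).hom) ∧
      (∀ v : V, ∃ W : V.Opens, IsAffineOpen W ∧ v ∈ W ∧ ∀ g : G, (ρV g).hom ⁻¹ᵁ W = W) ∧
      ∀ (g : G) (v : V) (hv : (ρV g).hom.base v = v),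
        (Ideal.span (Set.range fun s : V.presheaf.stalk v =>
          (V.presheaf.stalkSpecializes (specializes_of_eq hv) ≫ (ρV g).hom.stalkMap v).hom s -
            s)).IsPrincipal

/-- `CyclicDivisorialModelsLE` is antitone in the dimension bound. [folklore] -/
theorem cyclicDivisorialModelsLE_mono {p₀ d d' : ℕ} (hd : d' ≤ d)
    (h : CyclicDivisorialModelsLE p₀ d) : CyclicDivisorialModelsLE p₀ d' := by
  intro p hp hpp₀ k _ _ _ X' X₁ f q G _ _ ρ hcard hfaith hsep hft hqc hX₁ hX' hreg hq hρ hdim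
  exact h p hp hpp₀ k X' X₁ f q G ρ hcard hfaith hsep hft hqc hX₁ hX' hreg hq hρ
    (hdim.trans (by exact_mod_cast hd))

/-- `CyclicDivisorialModelsLE` is antitone in the bound on the prime. [folklore] -/
theorem cyclicDivisorialModelsLE_mono_left {p₀ p₀' d : ℕ} (hp : p₀' ≤ p₀)
    (h : CyclicDivisorialModelsLE p₀ d) : CyclicDivisorialModelsLE p₀' d :=
  fun p hprime hpp₀ => h p hprime (hpp₀.trans hp)

/-- R0 `exists_stableAffineCover_of_isFinite`: the `G`-stable affine cover conjunct of the
terminal-model / Phase-0 statements is FREE for any `G`-invariant FINITE (indeed affine)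
`q : X′ → X₁`: pull back an affine open neighbourhood of `q x` (this is the landed
`PClosedCase.exists_isAffineOpen_stable`). [folklore; cf. MumfordAV1970 §7] -/
theorem exists_stableAffineCover_of_isFinite {X' X₁ : Scheme.{0}} (q : X' ⟶ X₁) [IsFinite q]
    {G : Type} [Group G] (ρ : G →* Aut X') (hρ : ∀ g : G, (ρ g).hom ≫ q = q) (x : X') :
    ∃ W : X'.Opens, IsAffineOpen W ∧ x ∈ W ∧ ∀ g : G, (ρ g).hom ⁻¹ᵁ W = W :=
  PClosedCase.exists_isAffineOpen_stable q ρ hρ x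

/-- On a regular scheme of dimension `≤ 1` every ideal of every local ring is principal: the
local ring `𝒪_{X,x}` is a regular local ring of dimension `≤ dim X ≤ 1`
(`Scheme.topologicalKrullDim_eq_iSup_ringKrullDim_stalk`), hence a field or a discrete valuation
ring (`isPrincipalIdealRing_of_ringKrullDim_le_one`). [folklore] -/
theorem isPrincipal_stalk_of_topologicalKrullDim_le_one {X : Scheme.{0}} (hreg : Scheme.IsRegular X)
    (hdim : topologicalKrullDim X ≤ 1) (x : X) (I : Ideal (X.presheaf.stalk x)) :
    I.IsPrincipal := by
  have hst : ringKrullDim (X.presheaf.stalk x) ≤ 1 := by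
    have h := le_iSup (fun y : X => ringKrullDim (X.presheaf.stalk y)) x
    rw [← Scheme.topologicalKrullDim_eq_iSup_ringKrullDim_stalk] at h
    exact h.trans hdim
  haveI := hreg x
  haveI : IsPrincipalIdealRing (X.presheaf.stalk x) := isPrincipalIdealRing_of_ringKrullDim_le_one hst
  exact IsPrincipalIdealRing.principal I

/-- R1a rung `cyclicDivisorialModelsLE_one`: **in dimension `≤ 1` the regular `X′` is ITS OWN
terminal model.** `dim X′ ≤ dim X₁ ≤ 1` for the finite `q`
(`Scheme.topologicalKrullDim_le_of_locallyQuasiFinite`), so the stalks of `X′` are fields or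
discrete valuation rings and every stalk augmentation ideal is principal
(`isPrincipal_stalk_of_topologicalKrullDim_le_one`); the identity is proper and birational, and
the `G`-stable affine cover is `exists_stableAffineCover_of_isFinite`. [folklore] -/
theorem cyclicDivisorialModelsLE_one (p₀ : ℕ) : CyclicDivisorialModelsLE p₀ 1 := by
  intro p hp hpp₀ k _ _ _ X' X₁ f q G _ _ ρ hcard hfaith hsep hft hqc hX₁ hX' hreg hq hρ hdim
  haveI := hq
  haveI := hX'
  refine ⟨X', 𝟙 X', ρ, inferInstance, ⟨⊤, by simp, by simp, inferInstance⟩, hX', hreg,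
    fun g => by simp, exists_stableAffineCover_of_isFinite q ρ hρ, fun g v hv => ?_⟩
  have hdimX' : topologicalKrullDim X' ≤ 1 :=
    (Scheme.topologicalKrullDim_le_of_locallyQuasiFinite q).trans (by exact_mod_cast hdim)
  exact isPrincipal_stalk_of_topologicalKrullDim_le_one hreg hdimX' v _

end Summit.ResolutionOfSingularities.ResolutionOfSingularities.Theorems.WildQuotientResolution.CyclicTransfer

end
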